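import Mathlib
import HarnessLib
import Summits.Ventures.LatticeQCDFlow.Scaling.AutoregressiveGaugePlaquetteTVFloorAnyLink
import Summits.Ventures.LatticeQCDFlow.Scaling.AutoregressiveProposalKLChain

/-!
# LatticeQCDFlow / Scaling — THE STEP LOSS OF AN ENDPOINT-BLIND CONDITIONER GROWS WITHOUT BOUND AT WEAK
# COUPLING: `κ_e ≥ π_β{U_p ∈ B}·log(1/Haar(B)) − log 2` for every measurable `B ⊆ G` — every compact gauge
# group, every dimension, every volume, every coupling

HONEST FRAMING: exact (Metropolis-corrected) sampling algorithms for lattice gauge theory;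
figures of merit are autocorrelation/cost numbers at stated couplings and volumes; no
continuum-physics claim.

Venture `LatticeQCDFlow` (cell pub-lqcd), topic `Scaling`, FANOUT row 30 (lean-1, GEN-21) — OUR WORK on
THEORY-2.md §4 row C5.  The lineage's per-link loss floors (`f(r)²/2` from the plaquette mean, `2(π_β(B_ε) −
φ_ρ(ε))²` from the small ball) are bounded by `2`; the truth is unbounded.  A conditional for a link `e` that
does not read the other links at one endpoint of `e` is NO BETTER THAN FLAT in expected log-likelihood
(`Scaling/AutoregressiveGaugeVertexBlindProposal.integral_weight_mul_log_nonpos_of_vertexBlind`), so its step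
loss is at least the information of the exact conditional over Haar, `(1/Z)∫F log(A_sF/A_{insert e s}F) dπ`,
which the GIBBS INEQUALITY (`log x ≤ x − 1`) against the two-level density `r = a·𝟙_B/Haar B + (1 − a)·𝟙_{Bᶜ}`
bounds below through ANY measurable test set `B ⊆ G` for the plaquette holonomy — a redrawn link of the
plaquette makes the holonomy Haar (`integral_comp_plaquetteHolonomy_mul_of_mem`), so `∫ A_{insert e s}F·r(U_p)
dπ ≤ Z`.  With `B = B_ε = {‖ρ(g) − 1‖ ≤ ε}`: the floor tends to `log(1/φ_ρ(ε))` as `β → ∞` (`a → 1`),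
unbounded as `ε → 0` for a faithful `ρ` on an infinite group (`φ_ρ(ε) ≍ ε^{dim G}`).

## What is proved (all [ours]; `π = Haar^{⊗E}` on `(ℤ/L)^d`, `L ≥ 2`; continuous `ρ`, any real `β`,
`F = e^{−βS_W}`, `Z = ∫F dπ`; plaquette `p`, `e` any of its four links, `s` a set of links OFF `p`
(`N = A_sF`, `M = A_{insert e s}F`); `B ⊆ G` measurable with `Haar(B) > 0`)

* §1 **`wilson_condInfo_ge_ballMass_mul_log_of_weight`** — THE ENGINE (no conditioner), every weight
  `0 < a < 1`: `log(a/Haar B)·∫𝟙_B(U_p)·F dπ + log(1 − a)·∫𝟙_{Bᶜ}(U_p)·F dπ ≤ ∫ F·log(A_sF/A_{insert e s}F) dπ`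
  (so the floor per unit `Z` tends to the full Haar surprisal `log(1/Haar B)` as `π_β{U_p ∈ B} → 1`, `a → 1`);
  **`wilson_condInfo_ge_ballMass_mul_log`** — the half-weight form
  `log(1/Haar B)·∫𝟙_B(U_p)·F dπ − log 2·Z ≤ ∫ F·log(A_sF/A_{insert e s}F) dπ`.
* §2 **`wilson_stepKL_ge_ballMass_mul_log`** — `q` measurable, squeezed `0 < c_q ≤ q ≤ C_q`, normalised in
  `e`, not reading the links of `s`, blind to the other links at an endpoint `y` of `e`:
  `log(1/Haar B)·∫𝟙_B(U_p)·F dπ − log 2·Z ≤ ∫ F·log(A_sF/(q·A_{insert e s}F)) dπ = Z·κ_e`.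

READING (value-free): `κ_e ≥ π_β{U_p ∈ B}·log(1/Haar B) − log 2` for EVERY test set `B`; at weak coupling
the plaquette concentrates and the floor diverges logarithmically in the concentration scale.  NOT CLAIMED:
the sharp constant `dim G/2`; conditioners reading both endpoints; explicit small-ball masses.  No `def`,
no `sorry`, nothing cited as a fact beyond the tree.
-/

noncomputable section

namespace Summit.Ventures.LatticeQCDFlow.Theory2.Autoregressive

open MeasureTheory Function Set
open Literature.MathematicalPhysics.QuantumFieldTheory Literature.MathematicalPhysics.QuantumLattice
open Summit.Ventures.LatticeQCDFlow.Exactness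
open scoped Matrix Matrix.Norms.Frobenius

variable {d L N : ℕ} {G : Type*} [Group G] [TopologicalSpace G] [IsTopologicalGroup G]
  [CompactSpace G] [SecondCountableTopology G] [MeasurableSpace G] [BorelSpace G] [NeZero L]
  (ρ : G →* Matrix (Fin N) (Fin N) ℂ)

/-! ## §1 The information of the exact conditional over Haar -/

/-- **THE ENGINE — Gibbs against a two-level density.**  For every measurable `B ⊆ G` with `Haar(B) > 0`,
every weight `0 < a < 1`, every plaquette `p`, each of its links `e` and every set `s` of links off `p`:
`log(a/Haar B)·∫ 𝟙_B(U_p)·F dπ + log(1 − a)·∫ 𝟙_{Bᶜ}(U_p)·F dπ ≤ ∫ F·log(A_sF/A_{insert e s}F) dπ`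
(`F = e^{−βS_W}`; test density `r = a·𝟙_B/Haar B + (1 − a)·𝟙_{Bᶜ}`, `∫ r dHaar ≤ 1`). [ours] -/
theorem wilson_condInfo_ge_ballMass_mul_log_of_weight (hρ : Continuous ρ) (hL : 2 ≤ L) (β : ℝ)
    (p : Plaquette d L) {e : Edge d L}
    (he : e ∈ ({(p.1, p.2.1.1), (p.1.shift p.2.1.1, p.2.1.2), (p.1.shift p.2.1.2, p.2.1.1), (p.1, p.2.1.2)} :
      Finset (Edge d L)))
    {s : Finset (Edge d L)}
    (hs : s ⊆ Finset.univ \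
      {(p.1, p.2.1.1), (p.1.shift p.2.1.1, p.2.1.2), (p.1.shift p.2.1.2, p.2.1.1), (p.1, p.2.1.2)})
    {B : Set G} (hBm : MeasurableSet B) (hB0 : 0 < (haarProbability G).real B)
    {a : ℝ} (ha0 : 0 < a) (ha1 : a < 1) :
    Real.log (a / (haarProbability G).real B) *
          (∫ U, B.indicator (1 : G → ℝ) (plaquetteHolonomy U p.1 p.2.1.1 p.2.1.2) *
            Real.exp (-β * wilsonAction ρ U) ∂Measure.pi (fun _ : Edge d L => haarProbability G)) +
        Real.log (1 - a) * ((∫ U, Real.exp (-β * wilsonAction ρ U) ∂Measure.pi (fun _ : Edge d L => haarProbability G)) -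
          ∫ U, B.indicator (1 : G → ℝ) (plaquetteHolonomy U p.1 p.2.1.1 p.2.1.2) *
            Real.exp (-β * wilsonAction ρ U) ∂Measure.pi (fun _ : Edge d L => haarProbability G)) ≤
      ∫ U, Real.exp (-β * wilsonAction ρ U) *
          Real.log (coordAvg (haarProbability G) s (fun V : GaugeConfig d L G => Real.exp (-β * wilsonAction ρ V)) U /
            coordAvg (haarProbability G) (insert e s)
              (fun V : GaugeConfig d L G => Real.exp (-β * wilsonAction ρ V)) U)
        ∂Measure.pi (fun _ : Edge d L => haarProbability G) := by
  classical
  haveI : Fact (1 < L) := ⟨hL⟩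
  set μ := haarProbability G with hμ
  set π := Measure.pi (fun _ : Edge d L => μ) with hπ
  set x := p.1 with hx
  set k := p.2.1.1 with hk
  set l := p.2.1.2 with hl
  have hkl : k ≠ l := ne_of_lt p.2.2
  set φ : ℝ := μ.real B with hφ
  set F : GaugeConfig d L G → ℝ := fun V => Real.exp (-β * wilsonAction ρ V) with hF
  set Nf := coordAvg μ s F with hN'
  set M := coordAvg μ (insert e s) F with hM
  set Z : ℝ := ∫ U, F U ∂π with hZ
  set H : G → ℝ := B.indicator (1 : G → ℝ) with hH
  have hHm : Measurable H := measurable_const.indicator hBm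
  have hH01 : ∀ g, 0 ≤ H g ∧ H g ≤ 1 := fun g => by
    by_cases hg : g ∈ B
    · simp [hH, hg]
    · simp [hH, hg]
  have h1a : 0 < 1 - a := by linarith
  set r : G → ℝ := fun g => H g * (a / φ) + (1 - H g) * (1 - a) with hr
  have hrm : Measurable r := (hHm.mul_const _).add ((measurable_const.sub hHm).mul_const _)
  have hrpos : ∀ g, 0 < r g := fun g => by
    by_cases hg : g ∈ B
    · have : H g = 1 := by simp [hH, hg]
      simp only [hr, this]; norm_num; positivity
    · have : H g = 0 := by simp [hH, hg]
      simp only [hr, this]; norm_num; linarith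
  have hrb : ∀ g, |r g| ≤ a / φ + (1 - a) := fun g => by
    rw [abs_of_pos (hrpos g)]
    have h1 := hH01 g
    simp only [hr]
    nlinarith [h1.1, h1.2, show 0 < a / φ by positivity]
  have hlogr : ∀ g, Real.log (r g) = H g * Real.log (a / φ) + (1 - H g) * Real.log (1 - a) := fun g => by
    by_cases hg : g ∈ B
    · have : H g = 1 := by simp [hH, hg]
      simp only [hr, this]; norm_num
    · have : H g = 0 := by simp [hH, hg]
      simp only [hr, this]; norm_num
  have hint_r : ∫ g, r g ∂μ = a + (1 - a) * (1 - φ) := by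
    have hHi : Integrable H μ :=
      Integrable.mono' (integrable_const (1 : ℝ)) hHm.aestronglyMeasurable
        (ae_of_all _ fun g => by rw [Real.norm_eq_abs, abs_of_nonneg (hH01 g).1]; exact (hH01 g).2)
    have e1 : (fun g => r g) = fun g => H g * (a / φ - (1 - a)) + (1 - a) := by
      funext g; simp only [hr]; ring
    have hu : μ.real Set.univ = 1 := by simp [Measure.real]
    rw [e1, integral_add (hHi.mul_const _) (integrable_const _), integral_mul_const, hH,
      integral_indicator_one hBm, integral_const, smul_eq_mul, hu, ← hφ]
    field_simp
    ring
  obtain ⟨hFm, Bd, hFlo, hFhi⟩ := wilsonWeight_props (d := d) (L := L) ρ hρ β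
  have hcF : 0 < Real.exp (-(|β| * Bd)) := Real.exp_pos _
  have hFb : ∀ U, |F U| ≤ Real.exp (|β| * Bd) := fun U => by
    simp only [hF]; rw [abs_of_pos (Real.exp_pos _)]; exact hFhi U
  have hNf := fun U => coordAvg_pos_of_le μ s hFm hcF hFlo hFhi U
  have hMf := fun U => coordAvg_pos_of_le μ (insert e s) hFm hcF hFlo hFhi U
  have hNm : Measurable Nf := measurable_coordAvg _ s hFm
  have hMm : Measurable M := measurable_coordAvg _ (insert e s) hFm
  have hNabs : ∀ U, |Nf U| ≤ Real.exp (|β| * Bd) := fun U => by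
    rw [abs_of_pos (hNf U).1]; exact (hNf U).2.2
  have hMabs : ∀ U, |M U| ≤ Real.exp (|β| * Bd) := fun U => by rw [abs_of_pos (hMf U).1]; exact (hMf U).2.2
  have hMe : ∀ (U : GaugeConfig d L G) (v : G), M (update U e v) = M U := by
    intro U v
    refine coordAvg_congr_off (insert e s) F fun e' he' => ?_
    have : e' ≠ e := fun h => he' (h ▸ Finset.mem_insert_self e s)
    exact update_of_ne this _ _
  have hNs : ∀ U V : GaugeConfig d L G, Nf (s.piecewise V U) = Nf U := fun U V =>
    coordAvg_congr_off s F fun e' he' => Finset.piecewise_eq_of_notMem _ _ _ he'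
  have hMs : ∀ U V : GaugeConfig d L G, M (s.piecewise V U) = M U := fun U V =>
    coordAvg_congr_off (insert e s) F fun e' he' =>
      Finset.piecewise_eq_of_notMem _ _ _ (fun h => he' (Finset.mem_insert_of_mem h))
  have hn1 : ((x, k) : Edge d L) ∉ s := fun h => (Finset.mem_sdiff.1 (hs h)).2 (by simp)
  have hn2 : ((x.shift k, l) : Edge d L) ∉ s := fun h => (Finset.mem_sdiff.1 (hs h)).2 (by simp)
  have hn3 : ((x.shift l, k) : Edge d L) ∉ s := fun h => (Finset.mem_sdiff.1 (hs h)).2 (by simp)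
  have hn4 : ((x, l) : Edge d L) ∉ s := fun h => (Finset.mem_sdiff.1 (hs h)).2 (by simp)
  have hhol_s : ∀ U V : GaugeConfig d L G,
      plaquetteHolonomy (s.piecewise V U) x k l = plaquetteHolonomy U x k l := by
    intro U V
    simp only [plaquetteHolonomy, Finset.piecewise_eq_of_notMem _ _ _ hn1,
      Finset.piecewise_eq_of_notMem _ _ _ hn2, Finset.piecewise_eq_of_notMem _ _ _ hn3,
      Finset.piecewise_eq_of_notMem _ _ _ hn4]
  set b : ℝ := |β| * Bd with hb
  have hlogNM : ∀ U, |Real.log (Nf U / M U)| ≤ 2 * b := fun U => by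
    rw [Real.log_div (hNf U).1.ne' (hMf U).1.ne']
    have h1 : -b ≤ Real.log (Nf U) := by
      have := Real.log_le_log hcF (hNf U).2.1; rwa [Real.log_exp] at this
    have h2 : Real.log (Nf U) ≤ b := by
      have := Real.log_le_log (hNf U).1 (hNf U).2.2; rwa [Real.log_exp] at this
    have h3 : -b ≤ Real.log (M U) := by
      have := Real.log_le_log hcF (hMf U).2.1; rwa [Real.log_exp] at this
    have h4 : Real.log (M U) ≤ b := by
      have := Real.log_le_log (hMf U).1 (hMf U).2.2; rwa [Real.log_exp] at this
    rw [abs_le]; constructor <;> linarith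
  have hlogm : Measurable fun U => Real.log (Nf U / M U) := Real.measurable_log.comp (hNm.div hMm)
  -- Step 1: `∫ F log(N/M) = ∫ N log(N/M)`
  have h1 : ∫ U, F U * Real.log (Nf U / M U) ∂π = ∫ U, Nf U * Real.log (Nf U / M U) ∂π :=
    integral_coordAvg_mul_eq μ s hFm ⟨_, hFb⟩ hlogm ⟨_, hlogNM⟩
      (fun U V => by show Real.log _ = Real.log _; rw [hNs, hMs])
  -- Step 2: Gibbs pointwise: `N log(N/M) ≥ N − M r(U_p) + N log r(U_p)`
  have hgibbs : ∀ U, Nf U - M U * r (plaquetteHolonomy U x k l) +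
      Nf U * Real.log (r (plaquetteHolonomy U x k l)) ≤ Nf U * Real.log (Nf U / M U) := by
    intro U
    have hN0 := (hNf U).1
    have hM0 := (hMf U).1
    have hr0 := hrpos (plaquetteHolonomy U x k l)
    set t : ℝ := M U * r (plaquetteHolonomy U x k l) / Nf U with ht
    have ht0 : 0 < t := by positivity
    have hlog := Real.log_le_sub_one_of_pos ht0
    have elog : Real.log t = Real.log (M U) + Real.log (r (plaquetteHolonomy U x k l)) - Real.log (Nf U) := by
      rw [ht, Real.log_div (by positivity) hN0.ne', Real.log_mul hM0.ne' hr0.ne']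
    have ediv : Real.log (Nf U / M U) = Real.log (Nf U) - Real.log (M U) := Real.log_div hN0.ne' hM0.ne'
    have key : Nf U * Real.log t ≤ Nf U * (t - 1) := mul_le_mul_of_nonneg_left hlog hN0.le
    have et : Nf U * (t - 1) = M U * r (plaquetteHolonomy U x k l) - Nf U := by
      rw [ht, mul_sub, mul_one, mul_div_cancel₀ _ hN0.ne']
    rw [et, elog] at key
    rw [ediv]
    nlinarith [key]
  have hXm : Measurable fun U : GaugeConfig d L G => r (plaquetteHolonomy U x k l) :=
    hrm.comp (measurable_plaquetteHolonomy x k l)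
  have hiN : Integrable Nf π := integrable_pi_of_abs_le μ hNm hNabs
  have hiMr : Integrable (fun U => M U * r (plaquetteHolonomy U x k l)) π :=
    integrable_pi_of_abs_le μ (hMm.mul hXm) (C := Real.exp (|β| * Bd) * (a / φ + (1 - a)))
      (fun U => by rw [abs_mul]; exact mul_le_mul (hMabs U) (hrb _) (abs_nonneg _) (Real.exp_pos _).le)
  have hlogrb : ∀ g, |Real.log (r g)| ≤ |Real.log (a / φ)| + |Real.log (1 - a)| := fun g => by
    rw [hlogr]
    have h1 := hH01 g
    calc |H g * Real.log (a / φ) + (1 - H g) * Real.log (1 - a)|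
        ≤ |H g * Real.log (a / φ)| + |(1 - H g) * Real.log (1 - a)| := abs_add_le _ _
      _ ≤ |Real.log (a / φ)| + |Real.log (1 - a)| := by
          rw [abs_mul, abs_mul, abs_of_nonneg h1.1, abs_of_nonneg (by linarith [h1.2] : (0 : ℝ) ≤ 1 - H g)]
          nlinarith [abs_nonneg (Real.log (a / φ)), abs_nonneg (Real.log (1 - a)), h1.1, h1.2]
  have hiNlogr : Integrable (fun U => Nf U * Real.log (r (plaquetteHolonomy U x k l))) π :=
    integrable_pi_of_abs_le μ (hNm.mul (Real.measurable_log.comp hXm))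
      (C := Real.exp (|β| * Bd) * (|Real.log (a / φ)| + |Real.log (1 - a)|))
      (fun U => by rw [abs_mul]; exact mul_le_mul (hNabs U) (hlogrb _) (abs_nonneg _) (Real.exp_pos _).le)
  have hiNlog : Integrable (fun U => Nf U * Real.log (Nf U / M U)) π :=
    integrable_pi_of_abs_le μ (hNm.mul hlogm) (C := Real.exp (|β| * Bd) * (2 * b))
      (fun U => by rw [abs_mul]; exact mul_le_mul (hNabs U) (hlogNM U) (abs_nonneg _) (Real.exp_pos _).le)
  -- Step 3: integrate the Gibbs inequality
  have hiNMr : Integrable (fun U => Nf U - M U * r (plaquetteHolonomy U x k l)) π := hiN.sub hiMr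
  have hiL : Integrable (fun U => Nf U - M U * r (plaquetteHolonomy U x k l) +
      Nf U * Real.log (r (plaquetteHolonomy U x k l))) π := hiNMr.add hiNlogr
  have h3 : ∫ U, Nf U ∂π - ∫ U, M U * r (plaquetteHolonomy U x k l) ∂π +
      ∫ U, Nf U * Real.log (r (plaquetteHolonomy U x k l)) ∂π ≤ ∫ U, Nf U * Real.log (Nf U / M U) ∂π := by
    have hm := integral_mono hiL hiNlog hgibbs
    rw [integral_add hiNMr hiNlogr, integral_sub hiN hiMr] at hm
    exact hm
  have hNZ : ∫ U, Nf U ∂π = Z := pi_integral_coordAvg μ s hFm hFb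
  have hMZ : ∫ U, M U ∂π = Z := pi_integral_coordAvg μ (insert e s) hFm hFb
  have hMr : ∫ U, M U * r (plaquetteHolonomy U x k l) ∂π = (a + (1 - a) * (1 - φ)) * Z := by
    have := integral_comp_plaquetteHolonomy_mul_of_mem (d := d) (L := L) hL x hkl he hrm hrb hMm hMabs hMe
    rw [← hμ, hint_r, hMZ] at this
    rw [← this]
    refine integral_congr_ae (ae_of_all _ fun U => ?_)
    ring
  have hHFm : Measurable fun U : GaugeConfig d L G => H (plaquetteHolonomy U x k l) :=
    hHm.comp (measurable_plaquetteHolonomy x k l)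
  have hHFb : ∀ U : GaugeConfig d L G, |H (plaquetteHolonomy U x k l)| ≤ 1 := fun U => by
    rw [abs_of_nonneg (hH01 _).1]; exact (hH01 _).2
  have hNH : ∫ U, Nf U * H (plaquetteHolonomy U x k l) ∂π = ∫ U, F U * H (plaquetteHolonomy U x k l) ∂π :=
    (integral_coordAvg_mul_eq μ s hFm ⟨_, hFb⟩ hHFm ⟨1, hHFb⟩ (fun U V => by simp only [hhol_s])).symm
  have hiNH : Integrable (fun U => Nf U * H (plaquetteHolonomy U x k l)) π :=
    integrable_pi_of_abs_le μ (hNm.mul hHFm) (C := Real.exp (|β| * Bd) * 1)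
      (fun U => by rw [abs_mul]; exact mul_le_mul (hNabs U) (hHFb U) (abs_nonneg _) (Real.exp_pos _).le)
  have hNlogr : ∫ U, Nf U * Real.log (r (plaquetteHolonomy U x k l)) ∂π =
      Real.log (a / φ) * ∫ U, F U * H (plaquetteHolonomy U x k l) ∂π +
        Real.log (1 - a) * (Z - ∫ U, F U * H (plaquetteHolonomy U x k l) ∂π) := by
    have e1 : (fun U => Nf U * Real.log (r (plaquetteHolonomy U x k l))) =
        fun U => Real.log (a / φ) * (Nf U * H (plaquetteHolonomy U x k l)) +
          (Real.log (1 - a) * Nf U - Real.log (1 - a) * (Nf U * H (plaquetteHolonomy U x k l))) := by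
      funext U; rw [hlogr]; ring
    have i1 : Integrable (fun U => Real.log (a / φ) * (Nf U * H (plaquetteHolonomy U x k l))) π :=
      hiNH.const_mul _
    have i2 : Integrable (fun U => Real.log (1 - a) * Nf U) π := hiN.const_mul _
    have i3 : Integrable (fun U => Real.log (1 - a) * (Nf U * H (plaquetteHolonomy U x k l))) π :=
      hiNH.const_mul _
    have i23 : Integrable (fun U => Real.log (1 - a) * Nf U -
        Real.log (1 - a) * (Nf U * H (plaquetteHolonomy U x k l))) π := i2.sub i3
    rw [e1, integral_add i1 i23, integral_sub i2 i3, integral_const_mul, integral_const_mul,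
      integral_const_mul, hNH, hNZ]
    ring
  have hslack : 0 ≤ (1 - a) * φ * Z := by
    have hZ0 : 0 ≤ Z := integral_nonneg fun U => (Real.exp_pos _).le
    have : 0 ≤ (1 - a) * φ := mul_nonneg h1a.le hB0.le
    exact mul_nonneg this hZ0
  rw [h1]
  have hcomm : ∫ U, H (plaquetteHolonomy U x k l) * F U ∂π = ∫ U, F U * H (plaquetteHolonomy U x k l) ∂π :=
    integral_congr_ae (ae_of_all _ fun U => mul_comm _ _)
  rw [hcomm]
  nlinarith [h3, hNZ, hMr, hNlogr, hslack]

/-- **The half-weight form**: `log(1/Haar B)·∫ 𝟙_B(U_p)·F dπ − log 2·Z ≤ ∫ F·log(A_sF/A_{insert e s}F) dπ`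
(`a = ½` in `wilson_condInfo_ge_ballMass_mul_log_of_weight`). [ours] -/
theorem wilson_condInfo_ge_ballMass_mul_log (hρ : Continuous ρ) (hL : 2 ≤ L) (β : ℝ)
    (p : Plaquette d L) {e : Edge d L}
    (he : e ∈ ({(p.1, p.2.1.1), (p.1.shift p.2.1.1, p.2.1.2), (p.1.shift p.2.1.2, p.2.1.1), (p.1, p.2.1.2)} :
      Finset (Edge d L)))
    {s : Finset (Edge d L)}
    (hs : s ⊆ Finset.univ \
      {(p.1, p.2.1.1), (p.1.shift p.2.1.1, p.2.1.2), (p.1.shift p.2.1.2, p.2.1.1), (p.1, p.2.1.2)})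
    {B : Set G} (hBm : MeasurableSet B) (hB0 : 0 < (haarProbability G).real B) :
    Real.log (1 / (haarProbability G).real B) *
          (∫ U, B.indicator (1 : G → ℝ) (plaquetteHolonomy U p.1 p.2.1.1 p.2.1.2) *
            Real.exp (-β * wilsonAction ρ U) ∂Measure.pi (fun _ : Edge d L => haarProbability G)) -
        Real.log 2 * ∫ U, Real.exp (-β * wilsonAction ρ U) ∂Measure.pi (fun _ : Edge d L => haarProbability G) ≤
      ∫ U, Real.exp (-β * wilsonAction ρ U) *
          Real.log (coordAvg (haarProbability G) s (fun V : GaugeConfig d L G => Real.exp (-β * wilsonAction ρ V)) U /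
            coordAvg (haarProbability G) (insert e s)
              (fun V : GaugeConfig d L G => Real.exp (-β * wilsonAction ρ V)) U)
        ∂Measure.pi (fun _ : Edge d L => haarProbability G) := by
  have h := wilson_condInfo_ge_ballMass_mul_log_of_weight (d := d) (L := L) ρ hρ hL β p he hs hBm hB0
    (a := 1 / 2) (by norm_num) (by norm_num)
  have e1 : Real.log (1 / 2 / (haarProbability G).real B) =
      Real.log (1 / (haarProbability G).real B) - Real.log 2 := by
    rw [show (1 : ℝ) / 2 / (haarProbability G).real B = (1 / (haarProbability G).real B) / 2 by ring,
      Real.log_div (by positivity) two_ne_zero]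
  have e2 : Real.log (1 - 1 / 2 : ℝ) = -Real.log 2 := by
    rw [show (1 - 1 / 2 : ℝ) = 1 / 2 by norm_num, Real.log_div one_ne_zero two_ne_zero, Real.log_one]
    ring
  rw [e1, e2] at h
  linarith

/-! ## §2 The step loss of an endpoint-blind conditioner -/

/-- **THE LOGARITHMIC STEP-LOSS FLOOR.**  Continuous `ρ`, `L ≥ 2`, any `β`; plaquette `p`, `e` any of its
links, `s` a set of links off `p`; `q` measurable with `0 < c_q ≤ q ≤ C_q`, normalised in `e`, not reading
the links of `s`, blind to every other link at an endpoint `y` of `e`; `B ⊆ G` measurable, `Haar(B) > 0`.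
Then `log(1/Haar B)·∫ 𝟙_B(U_p)·F dπ − log 2·Z ≤ ∫ F·log(A_sF/(q·A_{insert e s}F)) dπ` — in units of `Z`,
the training loss of the step generating `e` is at least `π_β{U_p ∈ B}·log(1/Haar B) − log 2`. [ours] -/
theorem wilson_stepKL_ge_ballMass_mul_log (hρ : Continuous ρ) (hL : 2 ≤ L) (β : ℝ)
    (p : Plaquette d L) {e : Edge d L}
    (he : e ∈ ({(p.1, p.2.1.1), (p.1.shift p.2.1.1, p.2.1.2), (p.1.shift p.2.1.2, p.2.1.1), (p.1, p.2.1.2)} :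
      Finset (Edge d L)))
    {s : Finset (Edge d L)}
    (hs : s ⊆ Finset.univ \
      {(p.1, p.2.1.1), (p.1.shift p.2.1.1, p.2.1.2), (p.1.shift p.2.1.2, p.2.1.1), (p.1, p.2.1.2)})
    {B : Set G} (hBm : MeasurableSet B) (hB0 : 0 < (haarProbability G).real B)
    {q : GaugeConfig d L G → ℝ} (hqm : Measurable q) {cq Cq : ℝ} (hcq : 0 < cq) (hqlo : ∀ U, cq ≤ q U)
    (hqhi : ∀ U, q U ≤ Cq) (hq1 : ∀ U, ∫ v, q (update U e v) ∂(haarProbability G) = 1)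
    (hqs : ∀ U V, q (s.piecewise V U) = q U)
    {y : Site d L} (hy : e.1 = y ∨ e.1.shift e.2 = y)
    (hqB : ∀ e' : Edge d L, e'.1 = y ∨ e'.1.shift e'.2 = y → e' ≠ e →
      ∀ (U : GaugeConfig d L G) (v : G), q (update U e' v) = q U) :
    Real.log (1 / (haarProbability G).real B) *
          (∫ U, B.indicator (1 : G → ℝ) (plaquetteHolonomy U p.1 p.2.1.1 p.2.1.2) *
            Real.exp (-β * wilsonAction ρ U) ∂Measure.pi (fun _ : Edge d L => haarProbability G)) -
        Real.log 2 * ∫ U, Real.exp (-β * wilsonAction ρ U) ∂Measure.pi (fun _ : Edge d L => haarProbability G) ≤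
      ∫ U, Real.exp (-β * wilsonAction ρ U) *
          Real.log (coordAvg (haarProbability G) s (fun V : GaugeConfig d L G => Real.exp (-β * wilsonAction ρ V)) U /
            (q U * coordAvg (haarProbability G) (insert e s)
              (fun V : GaugeConfig d L G => Real.exp (-β * wilsonAction ρ V)) U))
        ∂Measure.pi (fun _ : Edge d L => haarProbability G) := by
  classical
  haveI : Fact (1 < L) := ⟨hL⟩
  set μ := haarProbability G with hμ
  set π := Measure.pi (fun _ : Edge d L => μ) with hπ
  set F : GaugeConfig d L G → ℝ := fun V => Real.exp (-β * wilsonAction ρ V) with hF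
  set Nf := coordAvg μ s F with hN'
  set M := coordAvg μ (insert e s) F with hM
  obtain ⟨hFm, Bd, hFlo, hFhi⟩ := wilsonWeight_props (d := d) (L := L) ρ hρ β
  have hcF : 0 < Real.exp (-(|β| * Bd)) := Real.exp_pos _
  have hF0 : ∀ U, 0 ≤ F U := fun U => (Real.exp_pos _).le
  have hFb : ∀ U, |F U| ≤ Real.exp (|β| * Bd) := fun U => by
    simp only [hF]; rw [abs_of_pos (Real.exp_pos _)]; exact hFhi U
  have hNf := fun U => coordAvg_pos_of_le μ s hFm hcF hFlo hFhi U
  have hMf := fun U => coordAvg_pos_of_le μ (insert e s) hFm hcF hFlo hFhi U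
  have hNm : Measurable Nf := measurable_coordAvg _ s hFm
  have hMm : Measurable M := measurable_coordAvg _ (insert e s) hFm
  have hq0 : ∀ U, 0 < q U := fun U => hcq.trans_le (hqlo U)
  have hsplit : ∀ U, F U * Real.log (Nf U / (q U * M U)) =
      F U * Real.log (Nf U / M U) - F U * Real.log (q U) := fun U => by
    rw [show Nf U / (q U * M U) = (Nf U / M U) / q U by field_simp,
      Real.log_div (div_pos (hNf U).1 (hMf U).1).ne' (hq0 U).ne']
    ring
  set b : ℝ := |β| * Bd with hb
  have hlogNM : ∀ U, |Real.log (Nf U / M U)| ≤ 2 * b := fun U => by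
    rw [Real.log_div (hNf U).1.ne' (hMf U).1.ne']
    have h1 : -b ≤ Real.log (Nf U) := by
      have := Real.log_le_log hcF (hNf U).2.1; rwa [Real.log_exp] at this
    have h2 : Real.log (Nf U) ≤ b := by
      have := Real.log_le_log (hNf U).1 (hNf U).2.2; rwa [Real.log_exp] at this
    have h3 : -b ≤ Real.log (M U) := by
      have := Real.log_le_log hcF (hMf U).2.1; rwa [Real.log_exp] at this
    have h4 : Real.log (M U) ≤ b := by
      have := Real.log_le_log (hMf U).1 (hMf U).2.2; rwa [Real.log_exp] at this
    rw [abs_le]; constructor <;> linarith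
  have hlogq : ∀ U, |Real.log (q U)| ≤ |Real.log cq| + |Real.log Cq| := fun U => abs_le.2
    ⟨by linarith [Real.log_le_log hcq (hqlo U), neg_abs_le (Real.log cq), abs_nonneg (Real.log Cq)],
     by linarith [Real.log_le_log (hq0 U) (hqhi U), le_abs_self (Real.log Cq), abs_nonneg (Real.log cq)]⟩
  have hi1 : Integrable (fun U => F U * Real.log (Nf U / M U)) π :=
    integrable_pi_of_abs_le μ (hFm.mul (Real.measurable_log.comp (hNm.div hMm)))
      (C := Real.exp (|β| * Bd) * (2 * b))
      (fun U => by rw [abs_mul]; exact mul_le_mul (hFb U) (hlogNM U) (abs_nonneg _) (Real.exp_pos _).le)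
  have hi2 : Integrable (fun U => F U * Real.log (q U)) π :=
    integrable_pi_of_abs_le μ (hFm.mul (Real.measurable_log.comp hqm))
      (C := Real.exp (|β| * Bd) * (|Real.log cq| + |Real.log Cq|))
      (fun U => by rw [abs_mul]; exact mul_le_mul (hFb U) (hlogq U) (abs_nonneg _) (Real.exp_pos _).le)
  -- the blind conditioner is no better than flat in expected log-likelihood
  have hloop : e.1 ≠ e.1.shift e.2 := fun h => (site_shift_ne hL e.1 e.2) h.symm
  have hV : ∫ U, F U * Real.log (q U) ∂π ≤ 0 :=
    integral_weight_mul_log_nonpos_of_vertexBlind s (isGaugeInvariant_wilsonWeightFun ρ β) hFm hF0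
      ⟨_, hFhi⟩ hy hloop hqm ⟨cq, hcq, hqlo⟩ ⟨Cq, hqhi⟩ hqB hq1 hqs
  have hE := wilson_condInfo_ge_ballMass_mul_log (d := d) (L := L) ρ hρ hL β p he hs hBm hB0
  have hrw : ∫ U, F U * Real.log (Nf U / (q U * M U)) ∂π =
      ∫ U, F U * Real.log (Nf U / M U) ∂π - ∫ U, F U * Real.log (q U) ∂π := by
    rw [← integral_sub hi1 hi2]
    exact integral_congr_ae (ae_of_all _ hsplit)
  rw [hrw]
  linarith [hE, hV]

end Summit.Ventures.LatticeQCDFlow.Theory2.Autoregressive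

end
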